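import Literature.Claims.NS.Chae2007
import Literature.Claims.NS.ClayR3EnstrophyBridge
import Literature.Analysis.FunctionSpaces.Complexify
import Mathlib.Analysis.Fourier.FourierTransform
import Mathlib.Analysis.SpecialFunctions.Log.Base
import Mathlib.Analysis.SpecialFunctions.Pow.Deriv
import Mathlib.Analysis.SpecialFunctions.Pow.Continuity
import Mathlib.Analysis.Calculus.MeanValue
import HarnessLib

/-!
# Claim skeleton (D-0090 NS-CLAIMS, C162): Dodge, «Global Regularity of 3D Incompressible Navier-Stokes
# via Scale-Dependent Geometric Decoherence» (Zenodo 21515457, July 2026, 7 pp.)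

Typed skeleton of Dave Dodge (record creator «David Dodge»), *Global Regularity of 3D Incompressible
Navier-Stokes via Scale-Dependent Geometric Decoherence*, Zenodo record **21515457**
(doi 10.5281/zenodo.21515457; concept 21515456, single version; created 2026-07-23; ONE file
`NS_Regularity_Manuscript.pdf`, 226 724 B, md5 455dd7be…, PDF sha16 `f7522ad150b32a7a`; 7 pp.; PDF page =
file `pNNN`, no printed page numbers, no equation numbers) = bib `Dodge2026` = TEXT OF RECORD of cell
`ns-claims` row C162 (chair's choice, RULINGS v1.40 (1), lead-1 g5 2026-08-27T12:29:14Z; census menu A27,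
tail tranche 4d, T3 QUICK); census pin `run/shared/lean/pub/ns-claims/census/texts/Dodge2026/` (README
sha16 `c2b5b6a99a8aee94`); «p.N l.M» = line M of the pin's `pages/pNNN.txt`; lit seat's
`sources/Dodge2026/LOCATORS.md` v2 (ns-claims-lit-2 g6). Companions NOT typed (CARD §1 lineage only):
Zenodo 21515265 (same-day 5-pp. sheet, sha16 `d7040ad9a3ed84d1`, data «C^∞ ∩ L²», prints «C = 5^{j₀}·ν^{1.161}»
and Corollary 1's computation of 1/5), Zenodo 21515412 (8-pp. «16-Point Defense»), Zenodo 22085896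
(2026-08-24, metadata only). UNREFEREED CLAIM under adjudication — NOTHING in this file asserts a step
of the paper: the printed statements are `def … : Prop`; the `theorem`s are the kernel composition of
the paper's OWN implications, the Clay (A) link, the uniqueness half (a theorem of the tree in the class
typed here), Step 1 (the Beale–Kato–Majda dichotomy, a theorem of the tree), the paper's internal
derivation «From Lemmas 1–3 directly» (Step 5 from Steps 2–4), and two elementary arithmetic facts the
print states (triangle inequality; convergence of the geometric series of Lemma 1). Typist
`ns-claims-typist-6` g6; CARD `claims/Dodge2026/CARD.md` (PREDICTION sealed 2026-08-27T12:39:06Z, sha16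
`4f72cd5dc5725e7c`, written from RULINGS v1.40 (1) + census A27 + p.1 only). Verdict vocabulary is the
refuter's / referee's.

## The claimed statement, as printed (Theorem 1, p.4 l.2–3)
«Theorem 1 (Global Regularity). Let u₀ ∈ 𝒮(ℝ³) with ∇·u₀ = 0. Then the Navier-Stokes equations with
ν > 0 admit a unique smooth solution u ∈ C∞(ℝ³ × [0,∞)).» Setting §2 p.3 l.2–5: `∂ₜu + (u·∇)u + ∇p = νΔu`,
`∇·u = 0`, `u(x,0) = u₀(x)` on `ℝ³`, `ν > 0`, `u₀ ∈ 𝒮(ℝ³)` with `∇·u₀ = 0`; no force.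

RENDERING (the cell's ℝ³ convention, C17 `Chae2007` / C119 `Permana2026` / C156 `Alneel2026` /
C102 `Santak2026` — `lean search` done, vocabulary REUSED BY NAME, nothing re-declared): data =
`IsDatum` := smooth ∧ divergence-free ∧ rapid decay of every derivative (Fefferman's (4) =
`HasRapidSpatialDecay`; «𝒮(ℝ³)» — EXACTLY the Clay data class); «smooth solution u ∈ C∞(ℝ³ × [0,∞))»
of an argument that runs on the Beale–Kato–Majda criterion (p.3 l.13–15, p.5 l.23–24, ref. [5]) =
the cell's BKM class `Chae2007.IsGlobalSolution ν u₀ u p` / `Chae2007.IsLocalSolution ν T u₀ u p`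
(classical unforced solution, jointly smooth, all `L²` Sobolev norms bounded on compact time
intervals — the class in which BKM is a theorem of the tree); «unique» = `ClaimedUniqueness` (any two
global solutions of the class from `u₀` coincide — PROVED, `claimedUniqueness_holds`).
TODO(general form): solutions merely «smooth on ℝ³ × [0,∞)» with no growth condition (over that bare
class «unique» is false for trivial reasons — parasitic solutions `u = a(t)`, `p = −a′·x` — a typing
artefact the cell excludes by the class, ROUTE 5b F3).

## Clay delta (reference `Literature.Claims.NS.ClayVariants`; LOCATORS §2; REF-2 flag (a))
Nearest: (A) `ClayVariants.clayR3.Regularity`. Δ1 domain `ℝ³` = · Δ2 equations (1)(2), `ν > 0` = ·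
Δ3 force `≡ 0` = · Δ4 data «𝒮(ℝ³), ∇·u₀ = 0» = Clay (4) EXACTLY · Δ5 solution class: the print has no
pressure clause and no energy clause (6)/(7) — RECORDED, not added to `ClaimedTheorem`; in the BKM-class
rendering (7) follows from the tree's energy inequality `IsClassicalNSSolutionOn.bkm_energy_le`, so
`clay_of_claimed : ClaimedTheorem → clayR3.Regularity` is PROVED (the argument of
`Permana2026.clay_of_claimed`), and conversely `claimedExistence_of_clayA` (a Clay solution from a
(4)-datum is in the BKM class by `hasBoundedSobolevNormsOn_of_sobolevDatum_unforced`) — so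
`ClaimedExistence ↔ (A)` and `claimedTheorem_iff_clayA : ClaimedTheorem ↔ clayR3.Regularity`; Δ6 horizon `[0,∞)` = · Δ7 «ν > 0» arbitrary fixed =. No «wrong problem» axis.

## Posited objects (REF-2 flags (b)(c); chair's hazard note; RULINGS 11:21Z (1): posited objects are
## not steps) — carried by the parameter structure `Posits`, nothing about them is asserted here
The print never defines, as functionals of the solution: the «alignment fraction at the blow-up
scale» / «directional coherence» `f(t)` (p.4 l.9–10, p.5 l.6–11), the «interaction depth» `N`
(p.4 l.25, l.32–33, p.5 l.9), the «dominant frequency» / «active shell» `j` (p.4 l.31–32, p.5 l.8–9),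
and the «initial frequency j₀» of the datum (p.4 l.25, l.33) — for `𝒮(ℝ³)` data `û₀` has no top
frequency in general (LOCATORS §3; REF-2 (b)). They are typed as COMPONENTS of `P : Posits` with
exactly the properties the print states of them (Steps 2, 3, 4b, 6); a kernel refutation of a
`P`-indexed step has the shape `∀ P, ¬ Step P` (C102 `N` / C133 `B` / C149 `K`). The constant «C» of
the Proposition (p.5 l.7, l.12–14; manuscript gives no formula; the sheet prints «C = 5^{j₀}·ν^{1.161}»)
is typed as what the printed derivation l.8–10 produces: `Cgen P ν u₀ = 5^{j₀(u₀)} · ν^{β}`,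
`β = ln 5/(2 ln 2)` (p.5 l.7–8 «β = ln(5)/(2·ln2) = 1.161»); the exponents «0.839», «0.161», «1/0.161»
are typed exactly as `2 − β`, `β − 1`, `1/(β − 1)` (`one_lt_beta`, `beta_lt_two` PROVED).

## ORDERED STEP INDEX (dependency order = print order: BKM p.3 → Lemma 1 → Lemma 2 → Lemma 3 p.4 →
## Proposition p.5 l.6–10 → l.11 → l.12 → l.13–15 → BKM l.23–24; TYPING-HYGIENE 11)
* Step 1 = `Step1_BKM` — the Beale–Kato–Majda criterion p.3 l.13–15 + the local theory it runs on, in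
  the form §4 uses it (p.5 l.23–24): from every datum, EITHER a global solution of the class OR a finite
  `T*` and a class solution on `[0,T*)` whose BKM integral `∫₀^{T*} sup|ω|` diverges. TRUE — PROVED
  (`step1_holds`, tree `exists_global_bkmClass_or_blowup`).
* Step 2 = `Step2_L1survival P` — Lemma 1 p.4 l.9–10 «survival ≤ 1/5» with l.16–17 «coherence ≤ (1/5)^N»,
  AS CONSUMED p.5 l.9–10 («Lemma 1 bounds coherence survival at (1/5)^N»): along every class solution,
  `f(t) ≤ (1/5)^{N(t)}`. Posited `f`, `N`. Alongside, the ONE arithmetic display of Lemma 1, l.18–21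
  («decays as 2^{(2−2.322)j} … log₂(1/1/5) = 2.322 > 2 … The geometric series converges»):
  `L1_series` — TRUE, PROVED (`l1_series_holds`). The azimuthal display l.8 «∫₀²ᴨ⟨ê, P(k̂)·B(p̂(φ))⟩dφ = 0»
  has an undefined integrand «B» and is quoted, not typed; the sheet's Corollary 1 computation of 1/5
  (`⟨cos²θ⟩` under the `sin²θ`-weighted measure on S² = (4/15)/(4/3)) is lineage, not typed.
* Step 3 = `Step3_L2depth P` — Lemma 2 p.4 l.22–25 AS CONSUMED p.5 l.9: «Minimum interaction depth
  from initial frequency j₀ to shell j: N ≥ j − j₀» along every class solution. Posited `N`, `j`,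
  `j₀`. Alongside, its printed support l.23 «Triangle inequality on k₁ + k₂ = k₃: max(|k₁|,|k₂|) ≥
  |k₃|/2»: `L2_triangle` — TRUE, PROVED (`l2_triangle_holds`); the LP support sentence l.23–24 is
  quoted in the docstring (standard, not typed).
* Step 4a = `Step4a_L3support` — Lemma 3 p.4 l.27–29 AT THE PRINTED GRAIN (REF-2 flag (d)): «Let u be a
  divergence-free velocity field with ‖ω‖_{L∞} = M. By the standard Bernstein inequality … the
  high-frequency support of the vorticity field must satisfy supp(ω̂) ∩ {|k| ≥ (M/ν)^{1/2}} ≠ ∅» — a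
  statement about an ARBITRARY divergence-free field at a fixed time (typed over the paper's standing
  class: smooth, divergence-free, Schwartz, so that `ω̂` is the classical Fourier integral), with the
  non-degeneracy guard `0 < M` (the zero field has `ω̂ ≡ 0`; RULINGS 11:21Z (1) degenerate-witness rule —
  recorded). NOT a binder of `claim_of_steps`: the Proposition consumes Lemma 3 through 4b.
* Step 4b = `Step4b_L3active P` — Lemma 3's «Equivalently … In Littlewood-Paley: the dominant frequency j
  satisfies 2^j ≥ (M/ν)^{1/2}» (p.4 l.31–32) AS CONSUMED p.5 l.8–9 («requiring active shell j with
  2^j ≥ (‖ω‖/ν)^{1/2}»): along every class solution, at every time with `‖ω(t)‖_∞ > 0`. Posited `j`.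
  The printed «Equivalently» between 4a and 4b is not typable without a definition of `j` (recorded).
* Step 5 = `Step5_P1genealogy P` — Proposition p.5 l.6–10: «the alignment fraction at the blow-up scale
  satisfies f(t) ≤ C·‖ω(t)‖_{L∞}^{−β} where β = ln(5)/(2·ln2) = 1.161», with `C = Cgen` as the printed
  derivation l.8–10 produces it. DERIVED IN THE KERNEL from Steps 2, 3, 4b (`step5_of_steps`: the
  paper's «From Lemmas 1–3 directly» composes) — hence NOT a binder of `claim_of_steps`.
* Step 6 = `Step6_P2stretching P` — p.5 l.11 «the vortex stretching bound d‖ω‖_{L∞}/dt ≤ f(t)·‖ω‖²»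
  (quoted as known; not derived, not referenced — LOCATORS §3, REF-2 (c)), typed along every class
  solution on `[0,T)` in the C102 packaging: `‖ω(t)‖_∞` finite, `t ↦ ‖ω(t)‖_∞` continuous on `[0,T)`,
  differentiable on `(0,T)` with derivative `≤ f(t)‖ω(t)‖_∞²`. Posited `f`.
* Step 7 = `Step7_BernoulliODE` — p.5 l.12–15 «d‖ω‖/dt ≤ C·‖ω‖^{0.839} … sublinear Bernoulli ODE with
  maximum solution ‖ω(t)‖ ≤ (‖ω₀‖^{0.161} + 0.161·C·t)^{1/0.161}, growing at most polynomially», AT THE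
  FUNCTION GRAIN (TYPING-HYGIENE 13): every nonnegative continuous `Y` on `[0,T)`, differentiable on
  `(0,T)` with `Y′ ≤ C·Y^{2−β}`, obeys the printed majorant. TRUE — PROVED (`step7_holds`, fencing against the perturbed majorant
  `((Y(0)+ε)^{β−1} + (β−1)(C+ε)t)^{1/(β−1)}`, Mathlib `image_le_of_deriv_right_lt_deriv_boundary'`, then `ε → 0⁺`). The display l.12 itself («d‖ω‖/dt ≤ C·‖ω‖^{0.839}») is the kernel consequence of
  Steps 5–6 (`ode_of_steps`).
* The power-law ansatz p.5 l.4–5 («Assume finite-time blow-up: ‖ω(·,t)‖_{L∞} ~ A/(T*−t)^α …») and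
  the «Equivalently … α ≤ −6.21» reading l.15–17 are a second reading of the same contradiction
  (REF-2 (e)); the composition types the DIRECT chain l.6–15 + l.23–24; the ansatz is recorded, not
  typed. The Supplementary Track l.18–22 (extra physical assumption) is not on the path; not typed.
  §5–§8 (Euler distinction, discussion, «23-script computational verification suite», conclusion) and
  p.7 are not on the path; computational passages would be typed AS ASSERTED (RULINGS v1.39), none is
  consumed.

COMPOSITION: `claim_of_steps P : Step1_BKM → Step2_L1survival P → Step3_L2depth P → Step4b_L3active P →
Step6_P2stretching P → Step7_BernoulliODE → ClaimedTheorem` PROVED for every `P` (in the blow-up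
branch of Step 1, Steps 2–4b give Step 5, Steps 5–6 give `X′ ≤ Cgen·X^{2−β}` on `(0,T*)`, Step 7
bounds `X = ‖ω‖_∞` by the printed polynomial majorant on `[0,T*)`, so the BKM integral over `(0,T*)`
is finite — contradiction; the uniqueness half is `claimedUniqueness_holds`). With Steps 1 and 7
discharged: `claim_of_steps'` / `claim_of_steps''` — the claim follows from the four statements about
the posited objects alone (Steps 2, 3, 4b, 6). `clay_of_claimed : ClaimedTheorem → ClayVariants.clayR3.Regularity` and
`clay_of_steps` PROVED. Recorded, NOT adjudicated here (refuter/referee lanes): every binder except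
Steps 1 and 7 is a statement about the posited `f`, `N`, `j`, `j₀`; the field-level content of the
chain is Step 4a (and the arithmetic `L1_series`, `L2_triangle`).

Cell files: `claims/Dodge2026/CARD.md`, `RETYPE.md` (ns-claims-ref-2 g7, pre-registered
41553c45c29dc75e), `SALVAGE.md` (ns-claims-salvage-p6 g3), `kit-refuter1g4/`, `2read-typist4g5/`.
WHAT THIS IS NOT: not a claim about NS regularity or blow-up; not a claim about any author beyond the
typed locator.
-/

noncomputable section

open Set Function Filter MeasureTheory Topology FourierTransform
open scoped ENNReal NNReal ContDiff RealInnerProductSpace FourierTransform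

namespace Literature.Claims.NS.Dodge2026

open Literature.Analysis Literature.Analysis.FluidPDE Literature.Analysis.FunctionSpaces
  Literature.Claims.NS.ClayVariants
open Literature.Claims.NS.Chae2007 (IsLocalSolution IsGlobalSolution)

/-! ## Vocabulary -/

/-- `ℝ³` (§2 p.3 l.2–4). [cite: Dodge2026, §2 p.3 l.2–4] -/
abbrev E3 : Type := EuclideanSpace ℝ (Fin 3)

/-- `ℂ³` (target of the complexified Fourier integral `ω̂`, §2 p.3 l.6–8). [cite: Dodge2026, §2 p.3 l.6–8] -/
abbrev C3 : Type := EuclideanSpace ℂ (Fin 3)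

/-- **The data class of Theorem 1** (p.4 l.2, §2 p.3 l.5): «u₀ ∈ 𝒮(ℝ³) with ∇·u₀ = 0» — smooth,
divergence-free, every derivative decaying faster than any polynomial (Fefferman's (4),
`HasRapidSpatialDecay`): EXACTLY the Clay data class. [cite: Dodge2026, Thm 1 p.4 l.2; §2 p.3 l.5] -/
def IsDatum (u₀ : E3 → E3) : Prop :=
  ContDiff ℝ ∞ u₀ ∧ VectorCalculus.IsDivFree u₀ ∧ HasRapidSpatialDecay u₀

/-- `‖ω(t)‖_{L∞}` of a velocity slice `v`, `ω = ∇ × v`, in `[0,∞]` (junk-free). [cite: Dodge2026, p.3 l.13–15; p.4 l.27] -/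
def vortSup (v : E3 → E3) : ℝ≥0∞ := ⨆ x, ‖curl v x‖ₑ

/-- `‖ω(·,t)‖_{L∞}` along a velocity field `u` as a real number (`toReal`; the steps that use it carry
its finiteness). [cite: Dodge2026, Prop. p.5 l.4–15] -/
def X (u : ℝ → E3 → E3) (t : ℝ) : ℝ := (vortSup (u t)).toReal

/-- The complexified Fourier integral `ω̂` of the vorticity of a slice `v` (Mathlib's `Real.fourierIntegral` /
notation `𝓕` on `ℝ³`, characters `e^{−2πi⟨x,ξ⟩}`, fed through the coordinatewise complexification `ℝ³ → ℂ³`; for a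
Schwartz field this is the classical `ω̂`). [cite: Dodge2026, §2 p.3 l.6–8; Lemma 3 p.4 l.28–29] -/
def vortHat (v : E3 → E3) : E3 → C3 :=
  𝓕 (fun x : E3 => (EuclideanSpace.complexify (curl v x) : C3))

/-- `β = ln(5)/(2·ln 2)` («= 1.161», p.5 l.7–8). [cite: Dodge2026, Prop. p.5 l.7–8] -/
def β : ℝ := Real.log 5 / (2 * Real.log 2)

/-- **The posited objects of the chain** (never defined in the print as functionals of the solution;
REF-2 flags (b)(c); nothing about them is asserted here): the «alignment fraction» / «directional
coherence» `f` along a velocity field (p.4 l.9–10, p.5 l.6–11), the «interaction depth» `N` (p.4 l.25,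
l.32–33, p.5 l.9), the «dominant frequency» / «active shell» index `j` (p.4 l.31–32, p.5 l.8–9), and the
«initial frequency» `j₀` of a datum (p.4 l.25, l.33). [cite: Dodge2026, Lemma 1–3 p.4; Prop. p.5 l.6–11] -/
structure Posits where
  /-- `f(t)`: «the alignment fraction at the blow-up scale» along the velocity field `u`. -/
  f : (ℝ → E3 → E3) → ℝ → ℝ
  /-- `N(t)`: «interaction depth» from the initial frequency to the active shell at time `t`. -/
  N : (ℝ → E3 → E3) → ℝ → ℝ
  /-- `j(t)`: «the dominant frequency» / «active shell» (dyadic index, `2^j`) at time `t`. -/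
  j : (ℝ → E3 → E3) → ℝ → ℝ
  /-- `j₀`: «initial frequency» of the datum. -/
  j₀ : (E3 → E3) → ℝ

/-- The constant «C» of the Proposition as the printed derivation p.5 l.8–10 produces it from
«(1/5)^N», «N ≥ (1/2)·log₂(‖ω‖/ν) − j₀»: `C = 5^{j₀(u₀)} · ν^{β}` (the manuscript leaves `C` implicit,
l.7; the companion sheet 21515265 prints «C = 5^{j₀}·ν^{1.161}», p.3). [cite: Dodge2026, Prop. p.5 l.6–10] -/
def Cgen (P : Posits) (ν : ℝ) (u₀ : E3 → E3) : ℝ := (5 : ℝ) ^ P.j₀ u₀ * ν ^ β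

/-! ## The claimed statement (Theorem 1 p.4 l.2–3) -/

/-- **Existence half of Theorem 1**: for every `ν > 0` and every datum of the class, a global solution of
the class («admit a … smooth solution u ∈ C∞(ℝ³ × [0,∞))», rendered in the BKM class).
[claim: Dodge2026, status: under-review] [cite: Dodge2026, Thm 1 p.4 l.2–3] -/
def ClaimedExistence : Prop :=
  ∀ ν : ℝ, 0 < ν → ∀ u₀ : E3 → E3, IsDatum u₀ → ∃ (u : ℝ → E3 → E3) (p : ℝ → E3 → ℝ), IsGlobalSolution ν u₀ u p

/-- **Uniqueness half of Theorem 1** («a unique smooth solution»): two global solutions of the class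
from the same datum have the same velocity at all `t ≥ 0`. PROVED below (`claimedUniqueness_holds`).
[claim: Dodge2026, status: under-review] [cite: Dodge2026, Thm 1 p.4 l.2–3] -/
def ClaimedUniqueness : Prop :=
  ∀ ν : ℝ, 0 < ν → ∀ u₀ : E3 → E3, IsDatum u₀ →
    ∀ (u u' : ℝ → E3 → E3) (p p' : ℝ → E3 → ℝ),
      IsGlobalSolution ν u₀ u p → IsGlobalSolution ν u₀ u' p' → ∀ t : ℝ, 0 ≤ t → u' t = u t

/-- **CLAIMED THEOREM = Theorem 1 p.4 l.2–3** (existence ∧ uniqueness).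
[claim: Dodge2026, status: under-review] [cite: Dodge2026, Thm 1 p.4 l.2–3] -/
def ClaimedTheorem : Prop := ClaimedExistence ∧ ClaimedUniqueness

/-! ## The steps of the printed argument (no assertion) -/

/-- **Step 1 — the Beale–Kato–Majda criterion p.3 l.13–15** («If the maximal time of existence T* < ∞,
then ∫₀ᵀ* ‖ω(·,s)‖L∞ ds = ∞. Equivalently: if ‖ω‖L∞ remains bounded on [0,T] for all T < ∞, the solution
extends globally») together with the local theory it presupposes, in the form §4 uses it (p.5 l.23–24
«By BKM (1984): the solution remains smooth for all t > 0»): from every datum of the class, EITHER a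
global solution of the class exists, OR there are `T* > 0` and a class solution on `[0,T*)` whose BKM
integral over `(0,T*)` diverges. TRUE — `step1_holds` (tree `exists_global_bkmClass_or_blowup`,
Beale–Kato–Majda 1984 / Majda–Bertozzi 2002 Thm 3.6). [claim: Dodge2026, status: under-review]
[cite: Dodge2026, p.3 l.13–15; p.5 l.23–24] [cite: BealeKatoMajda1984, Thm. 1 and Corollary] -/
def Step1_BKM : Prop :=
  ∀ ν : ℝ, 0 < ν → ∀ u₀ : E3 → E3, IsDatum u₀ →
    (∃ (u : ℝ → E3 → E3) (p : ℝ → E3 → ℝ), IsGlobalSolution ν u₀ u p) ∨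
    ∃ Ts : ℝ, 0 < Ts ∧ ∃ (u : ℝ → E3 → E3) (p : ℝ → E3 → ℝ),
      IsLocalSolution ν Ts u₀ u p ∧ (∫⁻ t in Ioo 0 Ts, vortSup (u t)) = ⊤

/-- **Step 2 — Lemma 1 (Geometric Incompatibility of Transfer and Alignment) p.4 l.4–17, AS CONSUMED
p.5 l.9–10**: «The maximum achievable directional coherence surviving one triadic interaction is bounded
by: survival ≤ 1/5» (l.9–10), «enforcing the absolute multiplicative envelope: coherence ≤ (1/5)^N from
smooth initial data» (l.16–17), used as «Lemma 1 bounds coherence survival at (1/5)^N» (p.5 l.9–10):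
along every class solution on `[0,T)` from a datum of the class, the alignment fraction obeys
`f(t) ≤ (1/5)^{N(t)}`. Posited `f`, `N` (no definitions printed). [claim: Dodge2026, status: under-review]
[cite: Dodge2026, Lemma 1 p.4 l.9–10, l.16–17; Prop. p.5 l.9–10] -/
def Step2_L1survival (P : Posits) : Prop :=
  ∀ ν : ℝ, 0 < ν → ∀ (T : ℝ) (u₀ : E3 → E3) (u : ℝ → E3 → E3) (p : ℝ → E3 → ℝ), IsDatum u₀ →
    IsLocalSolution ν T u₀ u p → ∀ t ∈ Ico 0 T, P.f u t ≤ (1 / 5 : ℝ) ^ P.N u t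

/-- Lemma 1's arithmetic display p.4 l.18–21, «Volume Integral Convergence: The total coherent
contribution at shell j … decays as 2^{(2−2.322)j} = 2^{−0.322j} because log₂(1/1/5) = 2.322 > 2 = d−1.
… The geometric series converges absolutely»: `Σ_j 2^{(2 − log₂5)·j} < ∞`. TRUE — `l1_series_holds`
(ratio `4/5`). Alongside; not a binder. [claim: Dodge2026, status: under-review] [cite: Dodge2026, Lemma 1 p.4 l.18–21] -/
def L1_series : Prop :=
  Summable fun n : ℕ => (2 : ℝ) ^ ((2 - Real.logb 2 5) * n)

/-- **Step 3 — Lemma 2 (Minimum Interaction Depth) p.4 l.22–25, AS CONSUMED p.5 l.9**: «Minimum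
interaction depth from initial frequency j₀ to shell j: N ≥ j − j₀. Structural, speed-independent» —
along every class solution, at every time, the interaction depth to the active shell is at least
`j(t) − j₀(u₀)`. Posited `N`, `j`, `j₀` (for `𝒮(ℝ³)` data `û₀` has no top frequency in general; the
print gives no definition of `j₀` — recorded, REF-2 (b)). Printed support: the triangle inequality l.23
(`L2_triangle`, TRUE) and «supp(Δⱼu · Δₖu) ⊂ {|ξ| ~ max(2ʲ, 2ᵏ)} restricts frequency doubling per
bilinear interaction» (l.23–24; standard Littlewood–Paley support fact, quoted).
[claim: Dodge2026, status: under-review] [cite: Dodge2026, Lemma 2 p.4 l.22–25; Prop. p.5 l.9] -/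
def Step3_L2depth (P : Posits) : Prop :=
  ∀ ν : ℝ, 0 < ν → ∀ (T : ℝ) (u₀ : E3 → E3) (u : ℝ → E3 → E3) (p : ℝ → E3 → ℝ), IsDatum u₀ →
    IsLocalSolution ν T u₀ u p → ∀ t ∈ Ico 0 T, P.j u t - P.j₀ u₀ ≤ P.N u t

/-- Lemma 2's printed support p.4 l.23: «Triangle inequality on k₁ + k₂ = k₃: max(|k₁|, |k₂|) ≥ |k₃|/2».
TRUE — `l2_triangle_holds`. Alongside; not a binder. [claim: Dodge2026, status: under-review]
[cite: Dodge2026, Lemma 2 p.4 l.23] -/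
def L2_triangle : Prop :=
  ∀ k₁ k₂ : E3, ‖k₁ + k₂‖ / 2 ≤ max ‖k₁‖ ‖k₂‖

/-- **Step 4a — Lemma 3 (Viscous Support Ceiling via Bernstein Inequality) p.4 l.26–29, AT THE PRINTED
GRAIN** (REF-2 flag (d)): «Let u be a divergence-free velocity field with ‖ω‖_{L∞} = M. By the standard
Bernstein inequality for the Laplacian in L∞(ℝ³), the high-frequency support of the vorticity field must
satisfy supp(ω̂) ∩ {|k| ≥ (M/ν)^{1/2}} ≠ ∅.» A statement about an ARBITRARY field at a fixed time, for
every `ν > 0`: typed over smooth divergence-free Schwartz fields (the paper's standing class §2, so that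
`ω̂ = vortHat v` is the classical Fourier integral), `M` the least upper bound of `|ω|` (`IsLUB`, no
junk), with the non-degeneracy guard `0 < M` (for the zero field `ω̂ ≡ 0` and the display fails
trivially — degenerate-witness rule, recorded), `supp` = closed support (`tsupport`). NOT a binder of
`claim_of_steps` (the Proposition consumes Lemma 3 through Step 4b).
[claim: Dodge2026, status: under-review] [cite: Dodge2026, Lemma 3 p.4 l.26–29] -/
def Step4a_L3support : Prop :=
  ∀ ν : ℝ, 0 < ν → ∀ v : E3 → E3, ContDiff ℝ ∞ v → VectorCalculus.IsDivFree v → HasRapidSpatialDecay v →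
    ∀ M : ℝ, 0 < M → IsLUB (Set.range fun x => ‖curl v x‖) M →
      (tsupport (vortHat v) ∩ {ξ : E3 | Real.sqrt (M / ν) ≤ ‖ξ‖}).Nonempty

/-- **Step 4b — Lemma 3, Littlewood–Paley form p.4 l.31–32, AS CONSUMED p.5 l.8–9**: «Equivalently: the
blow-up scale satisfies ℓ ≤ (ν/M)^{1/2}. In Littlewood-Paley: the dominant frequency j satisfies
2^j ≥ (M/ν)^{1/2}», used as «Lemma 3 forces blow-up to scale ℓ ≤ (ν/‖ω‖)^{1/2}, requiring active shell
j with 2^j ≥ (‖ω‖/ν)^{1/2}»: along every class solution on `[0,T)`, at every time with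
`‖ω(t)‖_∞ > 0`, `(‖ω(t)‖_∞/ν)^{1/2} ≤ 2^{j(t)}`. Posited `j`; the printed «Equivalently» linking 4a to 4b
is not typable without a definition of `j` (recorded). [claim: Dodge2026, status: under-review]
[cite: Dodge2026, Lemma 3 p.4 l.31–33; Prop. p.5 l.8–9] -/
def Step4b_L3active (P : Posits) : Prop :=
  ∀ ν : ℝ, 0 < ν → ∀ (T : ℝ) (u₀ : E3 → E3) (u : ℝ → E3 → E3) (p : ℝ → E3 → ℝ), IsDatum u₀ →
    IsLocalSolution ν T u₀ u p → ∀ t ∈ Ico 0 T, 0 < X u t → Real.sqrt (X u t / ν) ≤ (2 : ℝ) ^ P.j u t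

/-- **Step 5 — Proposition (Self-Consistency Contradiction), Primary Track p.5 l.6–10**: «From Lemmas 1–3
directly, the alignment fraction at the blow-up scale satisfies f(t) ≤ C·‖ω(t)‖_{L∞}^{−β} where
β = ln(5)/(2·ln2) = 1.161. Derivation: Lemma 3 forces blow-up to scale ℓ ≤ (ν/‖ω‖)^{1/2}, requiring
active shell j with 2^j ≥ (‖ω‖/ν)^{1/2}. Lemma 2 gives interaction depth N ≥ (1/2)·log₂(‖ω‖/ν). Lemma 1
bounds coherence survival at (1/5)^N = (‖ω‖/ν)^{−1.161}» — along every class solution, at every time with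
`‖ω(t)‖_∞ > 0`, with `C = Cgen P ν u₀ = 5^{j₀}ν^{β}`. DERIVED in the kernel from Steps 2, 3, 4b
(`step5_of_steps`); not a binder. [claim: Dodge2026, status: under-review] [cite: Dodge2026, Prop. p.5 l.6–10] -/
def Step5_P1genealogy (P : Posits) : Prop :=
  ∀ ν : ℝ, 0 < ν → ∀ (T : ℝ) (u₀ : E3 → E3) (u : ℝ → E3 → E3) (p : ℝ → E3 → ℝ), IsDatum u₀ →
    IsLocalSolution ν T u₀ u p → ∀ t ∈ Ico 0 T, 0 < X u t → P.f u t ≤ Cgen P ν u₀ * X u t ^ (-β)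

/-- **Step 6 — the vortex stretching bound p.5 l.11**: «Substituting into the vortex stretching bound
d‖ω‖_{L∞}/dt ≤ f(t)·‖ω‖²» (quoted as known; not derived, not referenced): along every class solution on
`[0,T)` from a datum of the class, `‖ω(t)‖_∞` is finite on `[0,T)`, `t ↦ ‖ω(t)‖_∞` is continuous on
`[0,T)` and differentiable on `(0,T)` with derivative `≤ f(t)·‖ω(t)‖_∞²` (the C102 packaging of a
printed differential inequality, `Santak2026.Step4_ODE7`). Posited `f`.
[claim: Dodge2026, status: under-review] [cite: Dodge2026, Prop. p.5 l.11] -/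
def Step6_P2stretching (P : Posits) : Prop :=
  ∀ ν : ℝ, 0 < ν → ∀ (T : ℝ) (u₀ : E3 → E3) (u : ℝ → E3 → E3) (p : ℝ → E3 → ℝ), IsDatum u₀ →
    IsLocalSolution ν T u₀ u p →
      (∀ t ∈ Ico 0 T, vortSup (u t) < ⊤) ∧ ContinuousOn (X u) (Ico 0 T) ∧
        ∀ t ∈ Ioo 0 T, DifferentiableAt ℝ (X u) t ∧ deriv (X u) t ≤ P.f u t * X u t ^ 2

/-- **Step 7 — p.5 l.12–15 at the FUNCTION GRAIN** (TYPING-HYGIENE 13): «d‖ω‖/dt ≤ … = C·‖ω‖^{0.839}.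
Exponent 0.839 < 1. This is a sublinear Bernoulli ODE with maximum solution ‖ω(t)‖ ≤ (‖ω₀‖^{0.161} +
0.161·C·t)^{1/0.161}, growing at most polynomially»: for every `C ≥ 0`, every nonnegative `Y` continuous on
`[0,T)` and differentiable on `(0,T)` with `Y′ ≤ C·Y^{2−β}` there satisfies
`Y(t) ≤ (Y(0)^{β−1} + (β−1)·C·t)^{1/(β−1)}` on `[0,T)` (`2 − β` = «0.839», `β − 1` = «0.161»). TRUE —
PROVED below (`step7_holds`).
[claim: Dodge2026, status: under-review] [cite: Dodge2026, Prop. p.5 l.12–15] -/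
def Step7_BernoulliODE : Prop :=
  ∀ C : ℝ, 0 ≤ C → ∀ (T : ℝ) (Y : ℝ → ℝ), ContinuousOn Y (Ico 0 T) → (∀ t ∈ Ico 0 T, 0 ≤ Y t) →
    (∀ t ∈ Ioo 0 T, DifferentiableAt ℝ Y t ∧ deriv Y t ≤ C * Y t ^ (2 - β)) →
      ∀ t ∈ Ico 0 T, Y t ≤ (Y 0 ^ (β - 1) + (β - 1) * C * t) ^ (1 / (β - 1))

/-! ## Elementary facts about the printed constants -/

/-- `β > 1` (`ln 5 > 2 ln 2` since `5 > 4`): the printed «1.161 > 1», «0.839 < 1». [cite: Dodge2026, Prop. p.5 l.7–8, l.13] -/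
theorem one_lt_beta : 1 < β := by
  unfold β
  have h2 : 0 < Real.log 2 := Real.log_pos (by norm_num)
  rw [lt_div_iff₀ (by positivity), one_mul]
  have : Real.log 4 = 2 * Real.log 2 := by
    rw [show (4 : ℝ) = 2 ^ 2 by norm_num, Real.log_pow]; norm_num
  rw [← this]
  exact Real.log_lt_log (by norm_num) (by norm_num)

/-- `β < 2` (`ln 5 < 4 ln 2` since `5 < 16`): the printed exponent «0.839 = 2 − β» is positive.
[cite: Dodge2026, Prop. p.5 l.12] -/
theorem beta_lt_two : β < 2 := by
  unfold β
  have h2 : 0 < Real.log 2 := Real.log_pos (by norm_num)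
  rw [div_lt_iff₀ (by positivity)]
  have : Real.log 16 = 4 * Real.log 2 := by
    rw [show (16 : ℝ) = 2 ^ 4 by norm_num, Real.log_pow]; norm_num
  calc Real.log 5 < Real.log 16 := Real.log_lt_log (by norm_num) (by norm_num)
    _ = 2 * (2 * Real.log 2) := by rw [this]; ring

/-- `Cgen > 0` for `ν > 0`. [cite: Dodge2026, Prop. p.5 l.7] -/
theorem cgen_pos (P : Posits) {ν : ℝ} (hν : 0 < ν) (u₀ : E3 → E3) : 0 < Cgen P ν u₀ :=
  mul_pos (Real.rpow_pos_of_pos (by norm_num) _) (Real.rpow_pos_of_pos hν _)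

/-- `X ≥ 0` (`toReal` of an extended nonnegative real). [cite: Dodge2026, Prop. p.5 l.4] -/
theorem X_nonneg (u : ℝ → E3 → E3) (t : ℝ) : 0 ≤ X u t := ENNReal.toReal_nonneg

/-- The key identity behind «(1/5)^N = (‖ω‖/ν)^{−1.161}» (p.5 l.9–10): `(1/5)^{(log₂ x)/2} = x^{−β}` for
`x > 0`. [cite: Dodge2026, Prop. p.5 l.9–10] -/
theorem fifth_rpow_half_logb {x : ℝ} (hx : 0 < x) :
    (1 / 5 : ℝ) ^ (Real.logb 2 x / 2) = x ^ (-β) := by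
  rw [Real.rpow_def_of_pos (by norm_num : (0 : ℝ) < 1 / 5), Real.rpow_def_of_pos hx, Real.logb, β]
  congr 1
  have h5 : Real.log (1 / 5 : ℝ) = -Real.log 5 := by
    rw [one_div, Real.log_inv]
  rw [h5]
  have h2 : Real.log 2 ≠ 0 := (Real.log_pos (by norm_num)).ne'
  field_simp

/-! ## Kernel facts: Step 1, the arithmetic faces, uniqueness -/

/-- A Schwartz divergence-free datum is a datum of the BKM class (`Chae2007.IsDatum`: every derivative
in `L²`). [cite: Tao2013Localisation, Def. 1.1] -/
theorem isDatum_chae {u₀ : E3 → E3} (h : IsDatum u₀) : Chae2007.IsDatum u₀ :=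
  ⟨h.1, h.2.1, fun n => h.2.2.lintegral_enorm_iteratedFDeriv_sq_lt_top n⟩

/-- **Step 1 HOLDS**: the Beale–Kato–Majda dichotomy for `H^∞` data is a theorem of the tree
(`exists_global_bkmClass_or_blowup`). [cite: BealeKatoMajda1984, Thm. 1 and Corollary]
[cite: MajdaBertozzi2002, Thm. 3.6 and §3.3 (pp. 115–117)] -/
theorem step1_holds : Step1_BKM := by
  intro ν hν u₀ hu₀
  obtain ⟨hsm, hdiv, hH⟩ := isDatum_chae hu₀
  rcases exists_global_bkmClass_or_blowup hν.le hsm hdiv hH with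
    ⟨u, p, hu, hu0, hB, -⟩ | ⟨T, hT, u, p, hu, hu0, hreg, -, -, hint, -⟩
  · exact Or.inl ⟨u, p, ⟨hu, hu0, hB⟩⟩
  · exact Or.inr ⟨T, hT, u, p, ⟨hu, hu0, hreg⟩, hint⟩

/-- **`L2_triangle` HOLDS** (p.4 l.23): `|k₁ + k₂|/2 ≤ max(|k₁|, |k₂|)`. [cite: Dodge2026, Lemma 2 p.4 l.23] -/
theorem l2_triangle_holds : L2_triangle := by
  intro k₁ k₂
  have h := norm_add_le k₁ k₂
  have h1 := le_max_left ‖k₁‖ ‖k₂‖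
  have h2 := le_max_right ‖k₁‖ ‖k₂‖
  linarith

/-- **`L1_series` HOLDS** (p.4 l.18–21): `Σ_j 2^{(2 − log₂5)j}` is the geometric series of ratio
`2^{2 − log₂5} = 4/5 < 1`. [cite: Dodge2026, Lemma 1 p.4 l.18–21] -/
theorem l1_series_holds : L1_series := by
  unfold L1_series
  have hratio : (2 : ℝ) ^ (2 - Real.logb 2 5) = 4 / 5 := by
    rw [Real.rpow_sub (by norm_num), Real.rpow_logb (by norm_num) (by norm_num) (by norm_num)]
    norm_num
  have hterm : ∀ n : ℕ, (2 : ℝ) ^ ((2 - Real.logb 2 5) * n) = (4 / 5 : ℝ) ^ n := fun n => by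
    rw [Real.rpow_mul (by norm_num), hratio, Real.rpow_natCast]
  simp_rw [hterm]
  exact summable_geometric_of_lt_one (by norm_num) (by norm_num)

/-- **The uniqueness half of Theorem 1 HOLDS (kernel)** in the class typed here: two global BKM-class
solutions of the unforced system from the same datum coincide (Majda–Bertozzi Cor. 3.1 in the tree,
`IsClassicalNSSolutionOn.eq_of_hasBoundedSobolevNormsOn`, restricting both to `[0, t]`).
[cite: MajdaBertozzi2002, Cor. 3.1 (p. 88)] [cite: Dodge2026, Thm 1 p.4 l.2–3] -/
theorem claimedUniqueness_holds : ClaimedUniqueness := by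
  intro ν hν u₀ _ u u' p p' hu hu' t ht
  rcases ht.eq_or_lt with rfl | ht'
  · rw [hu'.initial, hu.initial]
  · exact IsClassicalNSSolutionOn.eq_of_hasBoundedSobolevNormsOn
      (hu'.isClassical.mono Icc_subset_Ici_self (uniqueDiffOn_Icc ht'))
      (hu.isClassical.mono Icc_subset_Ici_self (uniqueDiffOn_Icc ht')) hν.le ht'
      (hu'.sobolev t) (hu.sobolev t) (hu'.initial.trans hu.initial.symm) ⟨ht, le_rfl⟩

/-- Hence the claimed theorem is its existence half. [cite: Dodge2026, Thm 1 p.4 l.2–3] -/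
theorem claimedTheorem_iff_existence : ClaimedTheorem ↔ ClaimedExistence :=
  ⟨fun h => h.1, fun h => ⟨h, claimedUniqueness_holds⟩⟩

/-! ## The paper's internal derivation «From Lemmas 1–3 directly» (p.5 l.6–10) composes -/

/-- **Step 5 from Steps 2, 3, 4b** (p.5 l.8–10): `2^j ≥ (X/ν)^{1/2}` gives `j ≥ ½log₂(X/ν)`; `N ≥ j − j₀`
gives `N ≥ ½log₂(X/ν) − j₀`; `f ≤ (1/5)^N` and `1/5 < 1` give `f ≤ (1/5)^{½log₂(X/ν) − j₀} =
5^{j₀}·(X/ν)^{−β} = Cgen·X^{−β}`. [cite: Dodge2026, Prop. p.5 l.6–10] -/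
theorem step5_of_steps (P : Posits) (h2 : Step2_L1survival P) (h3 : Step3_L2depth P)
    (h4 : Step4b_L3active P) : Step5_P1genealogy P := by
  intro ν hν T u₀ u p hd hS t ht hX
  have hf := h2 ν hν T u₀ u p hd hS t ht
  have hN := h3 ν hν T u₀ u p hd hS t ht
  have hj := h4 ν hν T u₀ u p hd hS t ht hX
  have hXν : 0 < X u t / ν := div_pos hX hν
  -- `j ≥ ½ log₂ (X/ν)` from `2^j ≥ √(X/ν)`
  have hj' : Real.logb 2 (X u t / ν) / 2 ≤ P.j u t := by
    have hs : Real.sqrt (X u t / ν) = (X u t / ν) ^ (1 / 2 : ℝ) := Real.sqrt_eq_rpow _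
    have h1 : Real.logb 2 (Real.sqrt (X u t / ν)) ≤ Real.logb 2 ((2 : ℝ) ^ P.j u t) :=
      Real.logb_le_logb_of_le (by norm_num) (Real.sqrt_pos.2 hXν) hj
    rw [Real.logb_rpow (by norm_num) (by norm_num), hs, Real.logb_rpow_eq_mul_logb_of_pos hXν] at h1
    linarith
  -- `N ≥ ½ log₂ (X/ν) − j₀`
  have hN' : Real.logb 2 (X u t / ν) / 2 - P.j₀ u₀ ≤ P.N u t := by linarith
  -- antitonicity of `(1/5)^·`
  have hpow : (1 / 5 : ℝ) ^ P.N u t ≤ (1 / 5 : ℝ) ^ (Real.logb 2 (X u t / ν) / 2 - P.j₀ u₀) :=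
    Real.rpow_le_rpow_of_exponent_ge (by norm_num) (by norm_num) hN'
  refine hf.trans (hpow.trans (le_of_eq ?_))
  rw [Real.rpow_sub (by norm_num : (0 : ℝ) < 1 / 5), fifth_rpow_half_logb hXν,
    Real.div_rpow (X_nonneg u t) hν.le, Cgen]
  have h5 : (1 / 5 : ℝ) ^ P.j₀ u₀ = ((5 : ℝ) ^ P.j₀ u₀)⁻¹ := by
    rw [one_div, Real.inv_rpow (by norm_num)]
  rw [h5]
  have hνβ : ν ^ (-β) = (ν ^ β)⁻¹ := Real.rpow_neg hν.le β
  rw [hνβ]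
  have hν' : ν ^ β ≠ 0 := (Real.rpow_pos_of_pos hν β).ne'
  have h5' : (5 : ℝ) ^ P.j₀ u₀ ≠ 0 := (Real.rpow_pos_of_pos (by norm_num) _).ne'
  field_simp

/-- **The display p.5 l.12 from Steps 5–6** («d‖ω‖/dt ≤ C·‖ω‖^{−1.161}·‖ω‖² = C·‖ω‖^{0.839}»): along a
class solution on `[0,T)`, `X′(t) ≤ Cgen·X(t)^{2−β}` on `(0,T)` (at a time with `X(t) = 0` both sides
vanish). [cite: Dodge2026, Prop. p.5 l.11–12] -/
theorem ode_of_steps (P : Posits) (h5 : Step5_P1genealogy P) (h6 : Step6_P2stretching P) {ν : ℝ}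
    (hν : 0 < ν) {T : ℝ} {u₀ : E3 → E3} {u : ℝ → E3 → E3} {p : ℝ → E3 → ℝ} (hd : IsDatum u₀)
    (hS : IsLocalSolution ν T u₀ u p) :
    ∀ t ∈ Ioo 0 T, DifferentiableAt ℝ (X u) t ∧ deriv (X u) t ≤ Cgen P ν u₀ * X u t ^ (2 - β) := by
  intro t ht
  obtain ⟨-, -, hdiff⟩ := h6 ν hν T u₀ u p hd hS
  obtain ⟨hdt, hder⟩ := hdiff t ht
  refine ⟨hdt, hder.trans ?_⟩
  rcases (X_nonneg u t).eq_or_lt with hX0 | hXpos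
  · rw [← hX0, Real.zero_rpow (by linarith [beta_lt_two])]
    simp
  · have hf := h5 ν hν T u₀ u p hd hS t (Ioo_subset_Ico_self ht) hXpos
    calc P.f u t * X u t ^ 2 ≤ Cgen P ν u₀ * X u t ^ (-β) * X u t ^ 2 :=
          mul_le_mul_of_nonneg_right hf (sq_nonneg _)
      _ = Cgen P ν u₀ * X u t ^ (2 - β) := by
          rw [mul_assoc, show X u t ^ 2 = X u t ^ (2 : ℝ) by norm_cast,
            ← Real.rpow_add hXpos]
          ring_nf

/-! ## Step 7 is a theorem (ODE comparison, p.5 l.13–15) -/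

/-- The perturbed majorant `G_ε(s) = ((y₀ + ε)^{β−1} + (β−1)(C+ε)s)^{1/(β−1)}` used to fence `Y`.
[cite: Dodge2026, Prop. p.5 l.13–14] -/
private def Gmaj (C y₀ ε : ℝ) (s : ℝ) : ℝ :=
  ((y₀ + ε) ^ (β - 1) + (β - 1) * (C + ε) * s) ^ (1 / (β - 1))

/-- The base of the perturbed majorant is positive on `[0, ∞)`. [cite: Dodge2026, Prop. p.5 l.13–14] -/
private theorem gbase_pos {C y₀ ε s : ℝ} (hC : 0 ≤ C) (hy : 0 ≤ y₀) (hε : 0 < ε) (hs : 0 ≤ s) :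
    0 < (y₀ + ε) ^ (β - 1) + (β - 1) * (C + ε) * s := by
  have hδ : 0 < β - 1 := by linarith [one_lt_beta]
  have h1 : 0 < (y₀ + ε) ^ (β - 1) := Real.rpow_pos_of_pos (by linarith) _
  have h2 : 0 ≤ (β - 1) * (C + ε) * s := by positivity
  linarith

/-- `G_ε′ = (C + ε)·G_ε^{2−β}` on `[0, ∞)` (the majorant solves the perturbed Bernoulli equation).
[cite: Dodge2026, Prop. p.5 l.13–14] -/
private theorem hasDerivAt_gmaj {C y₀ ε s : ℝ} (hC : 0 ≤ C) (hy : 0 ≤ y₀) (hε : 0 < ε) (hs : 0 ≤ s) :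
    HasDerivAt (Gmaj C y₀ ε) ((C + ε) * Gmaj C y₀ ε s ^ (2 - β)) s := by
  have hδ : 0 < β - 1 := by linarith [one_lt_beta]
  have hb := gbase_pos hC hy hε hs
  have hlin : HasDerivAt (fun r : ℝ => (y₀ + ε) ^ (β - 1) + (β - 1) * (C + ε) * r)
      ((β - 1) * (C + ε)) s := by
    simpa using ((hasDerivAt_id s).const_mul ((β - 1) * (C + ε))).const_add ((y₀ + ε) ^ (β - 1))
  have hpow := hlin.rpow_const (p := 1 / (β - 1)) (Or.inl hb.ne')
  have key : (β - 1) * (C + ε) * (1 / (β - 1)) *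
      ((y₀ + ε) ^ (β - 1) + (β - 1) * (C + ε) * s) ^ (1 / (β - 1) - 1) =
      (C + ε) * Gmaj C y₀ ε s ^ (2 - β) := by
    unfold Gmaj
    rw [← Real.rpow_mul hb.le]
    have he : 1 / (β - 1) * (2 - β) = 1 / (β - 1) - 1 := by field_simp; ring
    rw [he]
    field_simp
  rw [← key]
  exact hpow

/-- `G_ε(0) = y₀ + ε`. [cite: Dodge2026, Prop. p.5 l.13–14] -/
private theorem gmaj_zero {C y₀ ε : ℝ} (hy : 0 ≤ y₀) (hε : 0 < ε) : Gmaj C y₀ ε 0 = y₀ + ε := by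
  have hδ : 0 < β - 1 := by linarith [one_lt_beta]
  unfold Gmaj
  rw [mul_zero, add_zero, ← Real.rpow_mul (by linarith), mul_one_div_cancel hδ.ne', Real.rpow_one]

/-- `G_ε` is nondecreasing on `[0, ∞)`. [cite: Dodge2026, Prop. p.5 l.13–14] -/
private theorem gmaj_mono {C y₀ ε s s' : ℝ} (hC : 0 ≤ C) (hy : 0 ≤ y₀) (hε : 0 < ε) (hs : 0 ≤ s)
    (hss' : s ≤ s') : Gmaj C y₀ ε s ≤ Gmaj C y₀ ε s' := by
  have hδ : 0 < β - 1 := by linarith [one_lt_beta]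
  unfold Gmaj
  refine Real.rpow_le_rpow (gbase_pos hC hy hε hs).le ?_ (by positivity)
  have : 0 ≤ (β - 1) * (C + ε) := by positivity
  nlinarith

/-- `G_ε > 0` on `[0, ∞)`. [cite: Dodge2026, Prop. p.5 l.13–14] -/
private theorem gmaj_pos {C y₀ ε s : ℝ} (hC : 0 ≤ C) (hy : 0 ≤ y₀) (hε : 0 < ε) (hs : 0 ≤ s) :
    0 < Gmaj C y₀ ε s :=
  Real.rpow_pos_of_pos (gbase_pos hC hy hε hs) _

/-- Fencing: under the hypotheses of Step 7, `Y(t) ≤ G_ε(t)` on `[0,T)` for every `ε > 0` (start the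
fence at a small `s > 0` where `Y(s) < Y(0) + ε ≤ G_ε(s)`; at a contact point `Y′ ≤ C·G_ε^{2−β} <
(C+ε)·G_ε^{2−β} = G_ε′`). [cite: Dodge2026, Prop. p.5 l.13–14] -/
private theorem le_gmaj {C T : ℝ} {Y : ℝ → ℝ} (hC : 0 ≤ C) (hc : ContinuousOn Y (Ico 0 T))
    (hY : ∀ t ∈ Ico 0 T, 0 ≤ Y t)
    (hd : ∀ t ∈ Ioo 0 T, DifferentiableAt ℝ Y t ∧ deriv Y t ≤ C * Y t ^ (2 - β))
    {ε : ℝ} (hε : 0 < ε) {t : ℝ} (ht : t ∈ Ico 0 T) : Y t ≤ Gmaj C (Y 0) ε t := by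
  have h0T : (0 : ℝ) ∈ Ico 0 T := ⟨le_rfl, ht.1.trans_lt ht.2⟩
  have hy0 : 0 ≤ Y 0 := hY 0 h0T
  rcases ht.1.eq_or_lt with h0 | htpos
  · rw [← h0, gmaj_zero hy0 hε]; linarith
  obtain ⟨δ, hδpos, hδ⟩ := Metric.continuousWithinAt_iff.1 (hc 0 h0T) ε hε
  set s : ℝ := min (δ / 2) t with hs
  have hs0 : 0 < s := lt_min (by linarith) htpos
  have hst : s ≤ t := min_le_right _ _
  have hsT : s ∈ Ico 0 T := ⟨hs0.le, hst.trans_lt ht.2⟩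
  have hYs : Y s ≤ Gmaj C (Y 0) ε s := by
    have h1 : dist (Y s) (Y 0) < ε := by
      refine hδ hsT ?_
      rw [dist_zero_right, Real.norm_eq_abs, abs_of_pos hs0]
      exact lt_of_le_of_lt (min_le_left _ _) (by linarith)
    rw [Real.dist_eq] at h1
    have h2 : Y s < Y 0 + ε := by linarith [le_abs_self (Y s - Y 0)]
    have h3 : Y 0 + ε ≤ Gmaj C (Y 0) ε s := by
      rw [← gmaj_zero (C := C) hy0 hε]; exact gmaj_mono hC hy0 hε le_rfl hs0.le
    linarith
  have hfence := image_le_of_deriv_right_lt_deriv_boundary' (f := Y) (f' := deriv Y) (a := s) (b := t)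
    (hc.mono fun x hx => ⟨hs0.le.trans hx.1, hx.2.trans_lt ht.2⟩)
    (fun x hx => ((hd x ⟨hs0.trans_le hx.1, hx.2.trans ht.2⟩).1.hasDerivAt).hasDerivWithinAt)
    (B := Gmaj C (Y 0) ε) (B' := fun x => (C + ε) * Gmaj C (Y 0) ε x ^ (2 - β)) hYs
    (fun x hx => (hasDerivAt_gmaj hC hy0 hε (hs0.le.trans hx.1)).continuousAt.continuousWithinAt)
    (fun x hx => (hasDerivAt_gmaj hC hy0 hε (hs0.le.trans hx.1)).hasDerivWithinAt)
    (fun x hx hxe => by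
      have hxT : x ∈ Ioo 0 T := ⟨hs0.trans_le hx.1, hx.2.trans ht.2⟩
      have hGp : 0 < Gmaj C (Y 0) ε x := gmaj_pos hC hy0 hε hxT.1.le
      have h1 := (hd x hxT).2
      rw [hxe] at h1
      have h2 : 0 < ε * Gmaj C (Y 0) ε x ^ (2 - β) := mul_pos hε (Real.rpow_pos_of_pos hGp _)
      linarith)
  exact hfence ⟨hst, le_rfl⟩

/-- **Step 7 HOLDS (kernel)** — p.5 l.13–15 at the function grain: a nonnegative `Y`, continuous on
`[0,T)` and differentiable on `(0,T)` with `Y′ ≤ C·Y^{2−β}`, obeys the printed majorant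
`Y(t) ≤ (Y(0)^{β−1} + (β−1)·C·t)^{1/(β−1)}` («sublinear Bernoulli ODE with maximum solution …, growing
at most polynomially»). Proof: fence against `G_ε` (`le_gmaj`) and let `ε → 0⁺`.
[cite: Dodge2026, Prop. p.5 l.13–15] -/
theorem step7_holds : Step7_BernoulliODE := by
  intro C hC T Y hc hY hd t ht
  have hδ : 0 < β - 1 := by linarith [one_lt_beta]
  have hev : ∀ᶠ ε in 𝓝[>] (0 : ℝ), Y t ≤ Gmaj C (Y 0) ε t :=
    eventually_nhdsWithin_of_forall fun ε hε => le_gmaj hC hc hY hd hε ht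
  have hcont : ContinuousAt (fun ε => Gmaj C (Y 0) ε t) 0 := by
    unfold Gmaj
    refine ContinuousAt.rpow_const ?_ (Or.inr (by positivity))
    refine ((continuousAt_const.add continuousAt_id).rpow_const (Or.inr hδ.le)).add ?_
    exact ((continuousAt_const.add continuousAt_id).const_mul (β - 1)).mul continuousAt_const
  have hlim : Tendsto (fun ε => Gmaj C (Y 0) ε t) (𝓝[>] 0) (𝓝 (Gmaj C (Y 0) 0 t)) :=
    hcont.tendsto.mono_left nhdsWithin_le_nhds
  have h := ge_of_tendsto hlim hev
  simpa [Gmaj] using h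

/-! ## Kernel composition and the Clay link -/

/-- A global solution of the class restricts to a class solution on every `[0,T)`.
[cite: MajdaBertozzi2002, Thm. 3.6 (the class)] -/
private theorem isLocalSolution_of_global {ν : ℝ} (T : ℝ) {u₀ : E3 → E3} {u : ℝ → E3 → E3}
    {p : ℝ → E3 → ℝ} (h : IsGlobalSolution ν u₀ u p) : IsLocalSolution ν T u₀ u p :=
  ⟨h.isClassical.mono Ico_subset_Ici_self (uniqueDiffOn_Ico 0 T), h.initial, fun T'' _ => h.sobolev T''⟩

/-- **COMPOSITION OF THE PRINTED CHAIN (PROVED, for every choice of the posited objects).** Fix `ν > 0`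
and a datum. Step 1: either a global class solution exists (and uniqueness is `claimedUniqueness_holds`),
or there is a finite `T*` with a class solution on `[0,T*)` whose BKM integral diverges. On `[0,T*)`:
Steps 2–4b give Step 5 (`step5_of_steps`), Steps 5–6 give `X′ ≤ Cgen·X^{2−β}` on `(0,T*)`
(`ode_of_steps`), Step 7 bounds `X(t)` by the printed polynomial majorant, which is at most its value
at `T*`; so `sup|ω(t)| ≤ B` on `[0,T*)` and `∫₀^{T*} sup|ω| ≤ B·T* < ∞` — contradiction (p.5 l.13–15,
l.23–24). Pure logic + bookkeeping; nothing asserted. [cite: Dodge2026, §3–§4 pp.4–5] -/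
theorem claim_of_steps (P : Posits) (h1 : Step1_BKM) (h2 : Step2_L1survival P) (h3 : Step3_L2depth P)
    (h4 : Step4b_L3active P) (h6 : Step6_P2stretching P) (h7 : Step7_BernoulliODE) : ClaimedTheorem := by
  refine ⟨?_, claimedUniqueness_holds⟩
  intro ν hν u₀ hd
  rcases h1 ν hν u₀ hd with hglob | ⟨Ts, hTs, u, p, hS, hint⟩
  · exact hglob
  · exfalso
    have h5 := step5_of_steps P h2 h3 h4
    obtain ⟨hfin, hcont, -⟩ := h6 ν hν Ts u₀ u p hd hS
    have hode := ode_of_steps P h5 h6 hν hd hS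
    set C := Cgen P ν u₀ with hC
    have hC0 : 0 ≤ C := (cgen_pos P hν u₀).le
    have hδ : 0 < β - 1 := by linarith [one_lt_beta]
    -- the printed polynomial majorant and its value at `T*`
    set B : ℝ := (X u 0 ^ (β - 1) + (β - 1) * C * Ts) ^ (1 / (β - 1)) with hB
    have hmaj : ∀ t ∈ Ico 0 Ts, X u t ≤ B := by
      intro t ht
      have h := h7 C hC0 Ts (X u) hcont (fun s _ => X_nonneg u s) hode t ht
      refine h.trans (Real.rpow_le_rpow ?_ ?_ (by positivity))
      · have : 0 ≤ X u 0 ^ (β - 1) := Real.rpow_nonneg (X_nonneg u 0) _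
        have : 0 ≤ (β - 1) * C * t := by have := ht.1; positivity
        linarith
      · have : (β - 1) * C * t ≤ (β - 1) * C * Ts := by
          have := ht.2.le; have : 0 ≤ (β - 1) * C := by positivity
          nlinarith
        linarith
    have hle : (∫⁻ t in Ioo 0 Ts, vortSup (u t)) ≤ ∫⁻ _ in Ioo 0 Ts, ENNReal.ofReal B := by
      refine setLIntegral_mono' measurableSet_Ioo fun t ht => ?_
      have ht' : t ∈ Ico 0 Ts := Ioo_subset_Ico_self ht
      rw [← ENNReal.ofReal_toReal (hfin t ht').ne]
      exact ENNReal.ofReal_le_ofReal (hmaj t ht')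
    have hlt : (∫⁻ t in Ioo 0 Ts, vortSup (u t)) < ⊤ := by
      refine lt_of_le_of_lt hle ?_
      rw [setLIntegral_const]
      exact ENNReal.mul_lt_top ENNReal.ofReal_lt_top (by simp [Real.volume_Ioo])
    exact hlt.ne hint

/-- With Step 1 discharged. [cite: Dodge2026, §3–§4 pp.4–5] -/
theorem claim_of_steps' (P : Posits) (h2 : Step2_L1survival P) (h3 : Step3_L2depth P)
    (h4 : Step4b_L3active P) (h6 : Step6_P2stretching P) (h7 : Step7_BernoulliODE) : ClaimedTheorem :=
  claim_of_steps P step1_holds h2 h3 h4 h6 h7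

/-- With Steps 1 AND 7 discharged: the claimed theorem follows from the four printed statements about
the posited objects (Steps 2, 3, 4b, 6) alone. [cite: Dodge2026, §3–§4 pp.4–5] -/
theorem claim_of_steps'' (P : Posits) (h2 : Step2_L1survival P) (h3 : Step3_L2depth P)
    (h4 : Step4b_L3active P) (h6 : Step6_P2stretching P) : ClaimedTheorem :=
  claim_of_steps P step1_holds h2 h3 h4 h6 step7_holds

/-- **CLAY LINK (PROVED)**: the claimed theorem implies Clay (A) (`ClayVariants.clayR3.Regularity`,
token for token the summit body): a Clay datum IS a datum of Theorem 1; the global class solution is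
smooth on `ℝ³ × [0,∞)` with `u(0) = u₀` (bridge `isNavierStokesSolution_and_smooth_iff`), and the energy
bound (7) holds with `C = ∫|u₀|²` by the tree's energy inequality in the BKM class
(`IsClassicalNSSolutionOn.bkm_energy_le`) — the argument of `Permana2026.clay_of_claimed`. No «wrong
problem» axis. [cite: FeffermanClay2006, (A) with (4) (6) (7) p. 2] [cite: Dodge2026, Thm 1 p.4 l.2–3] -/
theorem clay_of_claimed (h : ClaimedTheorem) : clayR3.Regularity := by
  intro ν hν u₀ hu₀ hdiv hdecay
  have hdat : IsDatum u₀ := ⟨hu₀, fun x => hdiv x, hdecay⟩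
  have hdat' := isDatum_chae hdat
  obtain ⟨u, p, hsol⟩ := h.1 ν hν u₀ hdat
  obtain ⟨hns, hsu, hsp⟩ :=
    (isNavierStokesSolution_and_smooth_iff (ν := ν) (f := 0) (u₀ := u₀) (u := u) (p := p)).2
      ⟨hsol.isClassical, hsol.initial⟩
  refine ⟨u, p, hsu, hsp, hns, ?_⟩
  show HasBoundedEnergy u
  have key : ∀ S : ℝ, 0 < S → ∀ τ ∈ Icc (0:ℝ) S,
      ∫⁻ x, ‖u τ x‖ₑ ^ 2 = ENNReal.ofReal (∫ x, ‖u τ x‖ ^ 2) := by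
    intro S hS τ hτ
    have hcl : IsClassicalNSSolutionOn (Icc 0 S) ν 0 u p :=
      hsol.isClassical.mono Icc_subset_Ici_self (uniqueDiffOn_Icc hS)
    obtain ⟨C, hC⟩ := hsol.sobolev S 0
    have hfin0 : ∫⁻ x, ‖iteratedFDeriv ℝ 0 (u τ) x‖ₑ ^ 2 < ⊤ := (hC τ hτ).trans_lt ENNReal.coe_lt_top
    have heq : (fun x => ‖iteratedFDeriv ℝ 0 (u τ) x‖ₑ ^ 2) = fun x => ‖u τ x‖ₑ ^ 2 := by
      funext x
      rw [← ofReal_norm, norm_iteratedFDeriv_zero, ofReal_norm]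
    have hfin : ∫⁻ x, ‖u τ x‖ₑ ^ 2 < ⊤ := by rwa [heq] at hfin0
    have hint : Integrable (fun x => ‖u τ x‖ ^ 2) :=
      integrable_sq_norm_of_lintegral_lt_top (hcl.contDiff_velocity hτ).continuous hfin
    rw [ofReal_integral_eq_lintegral_ofReal hint (Eventually.of_forall fun x => sq_nonneg _)]
    refine lintegral_congr fun x => ?_
    rw [← ofReal_norm, ENNReal.ofReal_pow (norm_nonneg _)]
  refine ⟨∫⁻ x, ‖u₀ x‖ₑ ^ 2, ?_, fun t ht => ?_⟩
  · have h0 := hdat'.2.2 0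
    have heq : (fun x => ‖iteratedFDeriv ℝ 0 u₀ x‖ₑ ^ 2) = fun x => ‖u₀ x‖ₑ ^ 2 := by
      funext x
      rw [← ofReal_norm, norm_iteratedFDeriv_zero, ofReal_norm]
    rwa [heq] at h0
  · have hT : (0:ℝ) < t + 1 := by linarith
    have hcl : IsClassicalNSSolutionOn (Icc 0 (t + 1)) ν 0 u p :=
      hsol.isClassical.mono Icc_subset_Ici_self (uniqueDiffOn_Icc hT)
    have hE : ∫ x, ‖u t x‖ ^ 2 ≤ ∫ x, ‖u 0 x‖ ^ 2 :=
      hcl.bkm_energy_le hν.le hT (hsol.sobolev (t + 1)) ⟨ht, by linarith⟩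
    rw [key (t + 1) hT t ⟨ht, by linarith⟩, ← hsol.initial, key (t + 1) hT 0 ⟨le_rfl, hT.le⟩]
    exact ENNReal.ofReal_le_ofReal hE

/-- **Conversely, Clay (A) gives the existence half** (so `ClaimedExistence ↔ (A)` exactly): a Clay
solution from a (4)-datum is a global solution of the BKM class — its `L²` Sobolev norms on every
`[0,T]` are bounded by the tree's persistence of regularity for finite-energy classical solutions from
an `H^∞` datum (`hasBoundedSobolevNormsOn_of_sobolevDatum_unforced`, Tao 2013 Cor. 11.1).
[cite: FeffermanClay2006, (A) p. 2] [cite: Tao2011, Cor. 11.1 (arXiv Cor. 68)] -/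
theorem claimedExistence_of_clayA (h : clayR3.Regularity) : ClaimedExistence := by
  intro ν hν u₀ hd
  obtain ⟨hsm, hdiv, hdec⟩ := hd
  have hS : clayR3.Solvable ν 0 u₀ := h ν hν u₀ hsm (fun x => hdiv x) hdec
  obtain ⟨w, q, hw, hw0, hwE⟩ := clayR3_solvable_zero_iff_classical.mp hS
  refine ⟨w, q, ⟨hw, hw0, fun T => ?_⟩⟩
  -- work on the positive slab `[0, max T 1]` and restrict
  have hT : (0 : ℝ) < max T 1 := lt_of_lt_of_le one_pos (le_max_right T 1)
  have hwT : IsClassicalNSSolutionOn (Icc 0 (max T 1)) ν 0 w q :=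
    hw.mono Icc_subset_Ici_self (uniqueDiffOn_Icc hT)
  have hwE'' : ∃ C : ℝ≥0, ∀ t ∈ Icc 0 (max T 1), ∫⁻ x, ‖w t x‖ₑ ^ 2 ≤ C := by
    obtain ⟨B, hB, hb⟩ := hwE
    exact ⟨B.toNNReal, fun t ht => (hb t ht.1).trans (ENNReal.coe_toNNReal hB.ne).ge⟩
  have h₀ : ∀ m : ℕ, ∫⁻ x, ‖iteratedFDeriv ℝ m (w 0) x‖ₑ ^ 2 < ⊤ := fun m => by
    rw [hw0]; exact sobolevDatum_of_rapidDecay hdec m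
  exact (hwT.hasBoundedSobolevNormsOn_of_sobolevDatum_unforced hν hT hwE'' h₀).mono
    (Icc_subset_Icc_right (le_max_left T 1))

/-- **`ClaimedExistence` is EXACTLY Clay (A)** in the cell's rendering. [cite: FeffermanClay2006, (A) p. 2]
[cite: Dodge2026, Thm 1 p.4 l.2–3] -/
theorem claimedExistence_iff_clayA : ClaimedExistence ↔ clayR3.Regularity :=
  ⟨fun h => clay_of_claimed ⟨h, claimedUniqueness_holds⟩, claimedExistence_of_clayA⟩

/-- **Theorem 1 as typed is EQUIVALENT to Clay (A)** (uniqueness in the class being a theorem of the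
tree). [cite: FeffermanClay2006, (A) p. 2] [cite: Dodge2026, Thm 1 p.4 l.2–3] -/
theorem claimedTheorem_iff_clayA : ClaimedTheorem ↔ clayR3.Regularity :=
  claimedTheorem_iff_existence.trans claimedExistence_iff_clayA

/-- With the steps, the printed chain would settle Clay (A). [cite: Dodge2026, §3–§4 pp.4–5]
[cite: FeffermanClay2006, (A) p. 2] -/
theorem clay_of_steps (P : Posits) (h1 : Step1_BKM) (h2 : Step2_L1survival P) (h3 : Step3_L2depth P)
    (h4 : Step4b_L3active P) (h6 : Step6_P2stretching P) (h7 : Step7_BernoulliODE) : clayR3.Regularity :=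
  clay_of_claimed (claim_of_steps P h1 h2 h3 h4 h6 h7)

/-! ## Rev 2 (ADDITIVE — nothing above is touched; REF-2 F-PASS 2026-08-27T13:04:01Z grain flag
RETYPE-6, 2-READ typist-4 g5 13:08:33Z): the Dini-derivative face of Step 6 and its composition

REF-2's keying analysis: `Step6_P2stretching P` carries the P-free clause `DifferentiableAt ℝ (X u) t`
(the C102 packaging), so `∀ P, ¬ Step6_P2stretching P` would follow from ONE class solution whose
`t ↦ ‖ω(t)‖_∞` has a kink — an artefact of the packaging, not of the print (p.5 l.11 writes the formal
derivative of a sup-norm). The print-faithful reading pre-registered by the referee (RETYPE-6) replaces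
the derivative by a one-sided Dini derivative. `Step6_Dini P` below types the WEAKEST such reading — the
lower right Dini derivative `lim inf_{z↓t} (X(z) − X(t))/(z − t) ≤ f(t)·X(t)²`, in Mathlib's
`∃ᶠ … slope` form — which is implied by the upper-Dini reading, by the a.e. reading with continuity,
and by `Step6_P2stretching` itself (`step6_dini_of_step6`); Step 7's comparison holds at that grain
(`Step7_Dini`, PROVED `step7_dini_holds`, same fence), and the chain re-composes:
`claim_of_steps_dini P : Step2 → Step3 → Step4b → Step6_Dini → ClaimedTheorem`. Lanes: key Step 6, if
at all, through `Step6_Dini`. -/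

/-- **Step 6, Dini face (RETYPE-6)** — p.5 l.11 «d‖ω‖_{L∞}/dt ≤ f(t)·‖ω‖²» read for the non-smooth
sup-norm: along every class solution on `[0,T)`, `‖ω(t)‖_∞` is finite, `t ↦ ‖ω(t)‖_∞` is continuous on
`[0,T)`, and at every `t ∈ (0,T)` its LOWER RIGHT DINI DERIVATIVE is `≤ f(t)·‖ω(t)‖_∞²` (for every
`r > f(t)X(t)²`, slopes `(X(z) − X(t))/(z − t) < r` occur for `z ↓ t` arbitrarily close to `t`).
Posited `f`. [claim: Dodge2026, status: under-review] [cite: Dodge2026, Prop. p.5 l.11] -/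
def Step6_Dini (P : Posits) : Prop :=
  ∀ ν : ℝ, 0 < ν → ∀ (T : ℝ) (u₀ : E3 → E3) (u : ℝ → E3 → E3) (p : ℝ → E3 → ℝ), IsDatum u₀ →
    IsLocalSolution ν T u₀ u p →
      (∀ t ∈ Ico 0 T, vortSup (u t) < ⊤) ∧ ContinuousOn (X u) (Ico 0 T) ∧
        ∀ t ∈ Ioo 0 T, ∀ r : ℝ, P.f u t * X u t ^ 2 < r → ∃ᶠ z in 𝓝[>] t, slope (X u) t z < r

/-- **Step 7, Dini face** — the comparison of p.5 l.13–15 at the function grain with the differential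
inequality read as a lower right Dini inequality: a nonnegative `Y`, continuous on `[0,T)`, with
`lim inf_{z↓t} slope ≤ C·Y(t)^{2−β}` at every `t ∈ (0,T)`, obeys the printed majorant. TRUE — PROVED
(`step7_dini_holds`). [claim: Dodge2026, status: under-review] [cite: Dodge2026, Prop. p.5 l.12–15] -/
def Step7_Dini : Prop :=
  ∀ C : ℝ, 0 ≤ C → ∀ (T : ℝ) (Y : ℝ → ℝ), ContinuousOn Y (Ico 0 T) → (∀ t ∈ Ico 0 T, 0 ≤ Y t) →
    (∀ t ∈ Ioo 0 T, ∀ r : ℝ, C * Y t ^ (2 - β) < r → ∃ᶠ z in 𝓝[>] t, slope Y t z < r) →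
      ∀ t ∈ Ico 0 T, Y t ≤ (Y 0 ^ (β - 1) + (β - 1) * C * t) ^ (1 / (β - 1))

/-- The C102-packaged Step 6 implies its Dini face (a derivative is a Dini derivative).
[cite: Dodge2026, Prop. p.5 l.11] -/
theorem step6_dini_of_step6 (P : Posits) (h : Step6_P2stretching P) : Step6_Dini P := by
  intro ν hν T u₀ u p hd hS
  obtain ⟨hfin, hcont, hdiff⟩ := h ν hν T u₀ u p hd hS
  refine ⟨hfin, hcont, fun t ht r hr => ?_⟩
  obtain ⟨hdt, hder⟩ := hdiff t ht
  exact (hdt.hasDerivAt.hasDerivWithinAt (s := Ici t)).liminf_right_slope_le (hder.trans_lt hr)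

/-- Fencing at the Dini grain: under the hypotheses of `Step7_Dini`, `Y(t) ≤ G_ε(t)` on `[0,T)` for every
`ε > 0`. [cite: Dodge2026, Prop. p.5 l.13–14] -/
private theorem le_gmaj_dini {C T : ℝ} {Y : ℝ → ℝ} (hC : 0 ≤ C) (hc : ContinuousOn Y (Ico 0 T))
    (hY : ∀ t ∈ Ico 0 T, 0 ≤ Y t)
    (hd : ∀ t ∈ Ioo 0 T, ∀ r : ℝ, C * Y t ^ (2 - β) < r → ∃ᶠ z in 𝓝[>] t, slope Y t z < r)
    {ε : ℝ} (hε : 0 < ε) {t : ℝ} (ht : t ∈ Ico 0 T) : Y t ≤ Gmaj C (Y 0) ε t := by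
  have h0T : (0 : ℝ) ∈ Ico 0 T := ⟨le_rfl, ht.1.trans_lt ht.2⟩
  have hy0 : 0 ≤ Y 0 := hY 0 h0T
  rcases ht.1.eq_or_lt with h0 | htpos
  · rw [← h0, gmaj_zero hy0 hε]; linarith
  obtain ⟨δ, hδpos, hδ⟩ := Metric.continuousWithinAt_iff.1 (hc 0 h0T) ε hε
  set s : ℝ := min (δ / 2) t with hs
  have hs0 : 0 < s := lt_min (by linarith) htpos
  have hst : s ≤ t := min_le_right _ _
  have hsT : s ∈ Ico 0 T := ⟨hs0.le, hst.trans_lt ht.2⟩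
  have hYs : Y s ≤ Gmaj C (Y 0) ε s := by
    have h1 : dist (Y s) (Y 0) < ε := by
      refine hδ hsT ?_
      rw [dist_zero_right, Real.norm_eq_abs, abs_of_pos hs0]
      exact lt_of_le_of_lt (min_le_left _ _) (by linarith)
    rw [Real.dist_eq] at h1
    have h2 : Y s < Y 0 + ε := by linarith [le_abs_self (Y s - Y 0)]
    have h3 : Y 0 + ε ≤ Gmaj C (Y 0) ε s := by
      rw [← gmaj_zero (C := C) hy0 hε]; exact gmaj_mono hC hy0 hε le_rfl hs0.le
    linarith
  have hfence := image_le_of_liminf_slope_right_lt_deriv_boundary' (f := Y)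
    (f' := fun x => C * Y x ^ (2 - β)) (a := s) (b := t)
    (hc.mono fun x hx => ⟨hs0.le.trans hx.1, hx.2.trans_lt ht.2⟩)
    (fun x hx r hr => hd x ⟨hs0.trans_le hx.1, hx.2.trans ht.2⟩ r hr)
    (B := Gmaj C (Y 0) ε) (B' := fun x => (C + ε) * Gmaj C (Y 0) ε x ^ (2 - β)) hYs
    (fun x hx => (hasDerivAt_gmaj hC hy0 hε (hs0.le.trans hx.1)).continuousAt.continuousWithinAt)
    (fun x hx => (hasDerivAt_gmaj hC hy0 hε (hs0.le.trans hx.1)).hasDerivWithinAt)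
    (fun x hx hxe => by
      have hxT : x ∈ Ioo 0 T := ⟨hs0.trans_le hx.1, hx.2.trans ht.2⟩
      have hGp : 0 < Gmaj C (Y 0) ε x := gmaj_pos hC hy0 hε hxT.1.le
      have h2 : 0 < ε * Gmaj C (Y 0) ε x ^ (2 - β) := mul_pos hε (Real.rpow_pos_of_pos hGp _)
      show C * Y x ^ (2 - β) < (C + ε) * Gmaj C (Y 0) ε x ^ (2 - β)
      rw [hxe]; linarith)
  exact hfence ⟨hst, le_rfl⟩

/-- **`Step7_Dini` HOLDS (kernel)** — the comparison of p.5 l.13–15 for the Dini inequality: fence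
against `G_ε` (`le_gmaj_dini`, Mathlib `image_le_of_liminf_slope_right_lt_deriv_boundary'`) and let
`ε → 0⁺`. [cite: Dodge2026, Prop. p.5 l.13–15] -/
theorem step7_dini_holds : Step7_Dini := by
  intro C hC T Y hc hY hd t ht
  have hδ : 0 < β - 1 := by linarith [one_lt_beta]
  have hev : ∀ᶠ ε in 𝓝[>] (0 : ℝ), Y t ≤ Gmaj C (Y 0) ε t :=
    eventually_nhdsWithin_of_forall fun ε hε => le_gmaj_dini hC hc hY hd hε ht
  have hcont : ContinuousAt (fun ε => Gmaj C (Y 0) ε t) 0 := by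
    unfold Gmaj
    refine ContinuousAt.rpow_const ?_ (Or.inr (by positivity))
    refine ((continuousAt_const.add continuousAt_id).rpow_const (Or.inr hδ.le)).add ?_
    exact ((continuousAt_const.add continuousAt_id).const_mul (β - 1)).mul continuousAt_const
  have hlim : Tendsto (fun ε => Gmaj C (Y 0) ε t) (𝓝[>] 0) (𝓝 (Gmaj C (Y 0) 0 t)) :=
    hcont.tendsto.mono_left nhdsWithin_le_nhds
  have h := ge_of_tendsto hlim hev
  simpa [Gmaj] using h

/-- **The display p.5 l.12 at the Dini grain from Steps 5 and 6 (Dini face)**: along a class solution on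
`[0,T)`, `lim inf_{z↓t} slope X ≤ Cgen·X(t)^{2−β}` at every `t ∈ (0,T)`.
[cite: Dodge2026, Prop. p.5 l.11–12] -/
theorem dini_ode_of_steps (P : Posits) (h5 : Step5_P1genealogy P) (h6 : Step6_Dini P) {ν : ℝ}
    (hν : 0 < ν) {T : ℝ} {u₀ : E3 → E3} {u : ℝ → E3 → E3} {p : ℝ → E3 → ℝ} (hd : IsDatum u₀)
    (hS : IsLocalSolution ν T u₀ u p) :
    ∀ t ∈ Ioo 0 T, ∀ r : ℝ, Cgen P ν u₀ * X u t ^ (2 - β) < r →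
      ∃ᶠ z in 𝓝[>] t, slope (X u) t z < r := by
  intro t ht r hr
  obtain ⟨-, -, hdini⟩ := h6 ν hν T u₀ u p hd hS
  refine hdini t ht r (lt_of_le_of_lt ?_ hr)
  rcases (X_nonneg u t).eq_or_lt with hX0 | hXpos
  · rw [← hX0, Real.zero_rpow (by linarith [beta_lt_two])]
    simp
  · have hf := h5 ν hν T u₀ u p hd hS t (Ioo_subset_Ico_self ht) hXpos
    calc P.f u t * X u t ^ 2 ≤ Cgen P ν u₀ * X u t ^ (-β) * X u t ^ 2 :=
          mul_le_mul_of_nonneg_right hf (sq_nonneg _)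
      _ = Cgen P ν u₀ * X u t ^ (2 - β) := by
          rw [mul_assoc, show X u t ^ 2 = X u t ^ (2 : ℝ) by norm_cast,
            ← Real.rpow_add hXpos]
          ring_nf

/-- **COMPOSITION AT THE DINI GRAIN (PROVED, ∀ P)** — Steps 2, 3, 4b and the Dini face of Step 6 give
the claimed theorem (Steps 1, 5, 7 being kernel theorems / derived): the same contradiction in the
blow-up branch, with `step7_dini_holds`. [cite: Dodge2026, §3–§4 pp.4–5] -/
theorem claim_of_steps_dini (P : Posits) (h2 : Step2_L1survival P) (h3 : Step3_L2depth P)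
    (h4 : Step4b_L3active P) (h6 : Step6_Dini P) : ClaimedTheorem := by
  refine ⟨?_, claimedUniqueness_holds⟩
  intro ν hν u₀ hd
  rcases step1_holds ν hν u₀ hd with hglob | ⟨Ts, hTs, u, p, hS, hint⟩
  · exact hglob
  · exfalso
    have h5 := step5_of_steps P h2 h3 h4
    obtain ⟨hfin, hcont, -⟩ := h6 ν hν Ts u₀ u p hd hS
    have hode := dini_ode_of_steps P h5 h6 hν hd hS
    set C := Cgen P ν u₀ with hC
    have hC0 : 0 ≤ C := (cgen_pos P hν u₀).le
    have hδ : 0 < β - 1 := by linarith [one_lt_beta]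
    set B : ℝ := (X u 0 ^ (β - 1) + (β - 1) * C * Ts) ^ (1 / (β - 1)) with hB
    have hmaj : ∀ t ∈ Ico 0 Ts, X u t ≤ B := by
      intro t ht
      have h := step7_dini_holds C hC0 Ts (X u) hcont (fun s _ => X_nonneg u s) hode t ht
      refine h.trans (Real.rpow_le_rpow ?_ ?_ (by positivity))
      · have : 0 ≤ X u 0 ^ (β - 1) := Real.rpow_nonneg (X_nonneg u 0) _
        have : 0 ≤ (β - 1) * C * t := by have := ht.1; positivity
        linarith
      · have : (β - 1) * C * t ≤ (β - 1) * C * Ts := by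
          have := ht.2.le; have : 0 ≤ (β - 1) * C := by positivity
          nlinarith
        linarith
    have hle : (∫⁻ t in Ioo 0 Ts, vortSup (u t)) ≤ ∫⁻ _ in Ioo 0 Ts, ENNReal.ofReal B := by
      refine setLIntegral_mono' measurableSet_Ioo fun t ht => ?_
      have ht' : t ∈ Ico 0 Ts := Ioo_subset_Ico_self ht
      rw [← ENNReal.ofReal_toReal (hfin t ht').ne]
      exact ENNReal.ofReal_le_ofReal (hmaj t ht')
    have hlt : (∫⁻ t in Ioo 0 Ts, vortSup (u t)) < ⊤ := by
      refine lt_of_le_of_lt hle ?_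
      rw [setLIntegral_const]
      exact ENNReal.mul_lt_top ENNReal.ofReal_lt_top (by simp [Real.volume_Ioo])
    exact hlt.ne hint

/-- Clay (A) from the Dini-grain chain. [cite: Dodge2026, §3–§4 pp.4–5] [cite: FeffermanClay2006, (A) p. 2] -/
theorem clay_of_steps_dini (P : Posits) (h2 : Step2_L1survival P) (h3 : Step3_L2depth P)
    (h4 : Step4b_L3active P) (h6 : Step6_Dini P) : clayR3.Regularity :=
  clay_of_claimed (claim_of_steps_dini P h2 h3 h4 h6)

/-! ## Rev 3 (ADDITIVE — nothing above is touched; theorems only): the chain's printed majorant BY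
NAME, at both grains, and the ν-face of its constant

For every `P`, Steps 2, 3, 4b and 6 (C102 grain or Dini grain) give, along every class solution on
`[0,T)`, the printed bound p.5 l.13–14 «‖ω(t)‖ ≤ (‖ω₀‖^{0.161} + 0.161·C·t)^{1/0.161}» with the constant the
printed derivation produces, `C = Cgen P ν u₀ = 5^{j₀(u₀)}·ν^{β}` (this is the `hmaj` step inside
`claim_of_steps`, now citable by name). Records (typist's CARD §5 ν-remark, not a reading of the print
beyond p.5 l.8–14 and §5 p.6 l.2–7): `Posits.j₀` sees the datum only, so at a fixed datum value and a
fixed time the majorant tends to `‖ω₀‖_∞` as `ν → 0⁺` (`majorant_tendsto_nu_zero`, pure arithmetic). -/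

/-- **The printed majorant along class solutions, from Steps 2, 3, 4b, 6 (∀ P)**: on `[0,T)`,
`‖ω(t)‖_∞ ≤ (‖ω₀‖_∞^{β−1} + (β−1)·Cgen·t)^{1/(β−1)}`, `Cgen = 5^{j₀(u₀)}·ν^{β}`.
[cite: Dodge2026, Prop. p.5 l.8–14] -/
theorem X_le_of_steps (P : Posits) (h2 : Step2_L1survival P) (h3 : Step3_L2depth P)
    (h4 : Step4b_L3active P) (h6 : Step6_P2stretching P) {ν : ℝ} (hν : 0 < ν) {T : ℝ} {u₀ : E3 → E3}
    {u : ℝ → E3 → E3} {p : ℝ → E3 → ℝ} (hd : IsDatum u₀) (hS : IsLocalSolution ν T u₀ u p) :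
    ∀ t ∈ Ico 0 T, X u t ≤ (X u 0 ^ (β - 1) + (β - 1) * Cgen P ν u₀ * t) ^ (1 / (β - 1)) := by
  obtain ⟨-, hcont, -⟩ := h6 ν hν T u₀ u p hd hS
  exact step7_holds (Cgen P ν u₀) (cgen_pos P hν u₀).le T (X u) hcont (fun s _ => X_nonneg u s)
    (ode_of_steps P (step5_of_steps P h2 h3 h4) h6 hν hd hS)

/-- **The printed majorant along class solutions at the Dini grain, from Steps 2, 3, 4b, 6-Dini (∀ P)**.
[cite: Dodge2026, Prop. p.5 l.8–14] -/
theorem X_le_of_steps_dini (P : Posits) (h2 : Step2_L1survival P) (h3 : Step3_L2depth P)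
    (h4 : Step4b_L3active P) (h6 : Step6_Dini P) {ν : ℝ} (hν : 0 < ν) {T : ℝ} {u₀ : E3 → E3}
    {u : ℝ → E3 → E3} {p : ℝ → E3 → ℝ} (hd : IsDatum u₀) (hS : IsLocalSolution ν T u₀ u p) :
    ∀ t ∈ Ico 0 T, X u t ≤ (X u 0 ^ (β - 1) + (β - 1) * Cgen P ν u₀ * t) ^ (1 / (β - 1)) := by
  obtain ⟨-, hcont, -⟩ := h6 ν hν T u₀ u p hd hS
  exact step7_dini_holds (Cgen P ν u₀) (cgen_pos P hν u₀).le T (X u) hcont (fun s _ => X_nonneg u s)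
    (dini_ode_of_steps P (step5_of_steps P h2 h3 h4) h6 hν hd hS)

/-- **The ν-face of the printed constant (arithmetic only)**: for a fixed datum `u₀` (so a fixed
`j₀(u₀)`), a fixed value `y₀ ≥ 0` of `‖ω₀‖_∞` and a fixed time `t`, the printed majorant
`(y₀^{β−1} + (β−1)·Cgen P ν u₀·t)^{1/(β−1)}` tends to `y₀` as `ν → 0⁺` (`Cgen = 5^{j₀(u₀)}·ν^{β}`,
`β > 1`). The print discusses ν only at ν = 0 (§5 p.6 l.2–7). [cite: Dodge2026, Prop. p.5 l.8–14; §5 p.6 l.2–7] -/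
theorem majorant_tendsto_nu_zero (P : Posits) (u₀ : E3 → E3) {y₀ : ℝ} (hy : 0 ≤ y₀) (t : ℝ) :
    Tendsto (fun ν : ℝ => (y₀ ^ (β - 1) + (β - 1) * Cgen P ν u₀ * t) ^ (1 / (β - 1)))
      (𝓝[>] 0) (𝓝 y₀) := by
  have hδ : 0 < β - 1 := by linarith [one_lt_beta]
  have hβ : 0 < β := by linarith [one_lt_beta]
  -- continuity of the majorant in `ν` at `ν = 0`
  have hC : ContinuousAt (fun ν : ℝ => Cgen P ν u₀) 0 := by
    unfold Cgen
    exact continuousAt_const.mul (Real.continuousAt_rpow_const 0 β (Or.inr hβ.le))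
  have hin : ContinuousAt (fun ν : ℝ => y₀ ^ (β - 1) + (β - 1) * Cgen P ν u₀ * t) 0 :=
    continuousAt_const.add ((continuousAt_const.mul hC).mul continuousAt_const)
  have hout : ContinuousAt
      (fun ν : ℝ => (y₀ ^ (β - 1) + (β - 1) * Cgen P ν u₀ * t) ^ (1 / (β - 1))) 0 :=
    hin.rpow_const (Or.inr (by positivity))
  have hlim := hout.tendsto.mono_left (nhdsWithin_le_nhds (s := Ioi (0 : ℝ)))
  -- the value at `ν = 0`
  have h0 : (y₀ ^ (β - 1) + (β - 1) * Cgen P 0 u₀ * t) ^ (1 / (β - 1)) = y₀ := by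
    have : Cgen P 0 u₀ = 0 := by
      unfold Cgen
      rw [Real.zero_rpow hβ.ne', mul_zero]
    rw [this, mul_zero, zero_mul, add_zero, ← Real.rpow_mul hy]
    rw [show (β - 1) * (1 / (β - 1)) = 1 by field_simp, Real.rpow_one]
  rw [h0] at hlim
  exact hlim

/-! ## The arithmetic behind «survival ≤ 1/5» (Lemma 1 p.4 l.9–10): a spherical AVERAGE

Appended by ns-claims-salvage-p6 g3 at the custodian's invitation (typist-6 g6, 13:48:48Z; rev 4,
append-only). The number `1/5` printed in Lemma 1 («survival ≤ 1/5 < 1/e») — sheet 21515265 Cor. 1: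
«analytical center: 1/5 (from ⟨cos²θ⟩ under T-weighted measure = (4/15)/(4/3))» — is the average of
`cos²θ` on `S²` against the weight `T = sin²θ` (surface element `sin θ dθ dφ`):
`∫₀^π sin³θ cos²θ dθ / ∫₀^π sin³θ dθ = (4/15)/(4/3) = 1/5`. TRUE arithmetic; alongside, not a binder
of `claim_of_steps`; it records that the printed `1/5` is an AVERAGE, not a bound on a defined quantity
(VERDICT 13:41:23Z / REF FORMAL 13:43:09Z key `Step2_L1survival`, where `f`, `N` are posited). -/

/-- `∫₀^π sin³θ · cos²θ dθ = 4/15` (substitution `u = cos θ`: `∫_{-1}^{1} u²(1 − u²) du`).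
[cite: Dodge2026, Lemma 1 p.4 l.9–10] -/
theorem integral_sin_cube_mul_cos_sq :
    ∫ x in (0:ℝ)..Real.pi, Real.sin x ^ 3 * Real.cos x ^ 2 = 4 / 15 := by
  have h := integral_sin_pow_odd_mul_cos_pow (a := 0) (b := Real.pi) 1 2
  norm_num at h
  rw [h]
  have : ∫ u in (-1:ℝ)..1, u ^ 2 * (1 - u ^ 2) = ∫ u in (-1:ℝ)..1, (u ^ 2 - u ^ 4) := by
    congr 1; funext u; ring
  rw [this, intervalIntegral.integral_sub (intervalIntegral.intervalIntegrable_pow 2)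
    (intervalIntegral.intervalIntegrable_pow 4), integral_pow, integral_pow]
  norm_num

/-- `∫₀^π sin³θ dθ = 4/3` (substitution `u = cos θ`: `∫_{-1}^{1} (1 − u²) du`).
[cite: Dodge2026, Lemma 1 p.4 l.9–10] -/
theorem integral_sin_cube : ∫ x in (0:ℝ)..Real.pi, Real.sin x ^ 3 = 4 / 3 := by
  have h := integral_sin_pow_odd_mul_cos_pow (a := 0) (b := Real.pi) 1 0
  simp only [pow_zero, mul_one, one_mul, Real.cos_zero, Real.cos_pi, pow_one] at h
  rw [show (2 * 1 + 1) = 3 from rfl] at h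
  rw [h, intervalIntegral.integral_sub intervalIntegrable_const
    (intervalIntegral.intervalIntegrable_pow 2), intervalIntegral.integral_const, integral_pow]
  norm_num

/-- Lemma 1's number p.4 l.9–10 «survival ≤ 1/5» (sheet Cor. 1 «⟨cos²θ⟩ under T-weighted measure =
(4/15)/(4/3)»): the `sin²θ dσ`-weighted spherical mean of `cos²θ` equals `1/5`. TRUE —
`l1_sphericalMean_holds`. Alongside; not a binder. [claim: Dodge2026, status: under-review]
[cite: Dodge2026, Lemma 1 p.4 l.9–10] -/
def L1_sphericalMean : Prop :=
  (∫ θ in (0:ℝ)..Real.pi, Real.sin θ ^ 3 * Real.cos θ ^ 2) /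
    (∫ θ in (0:ℝ)..Real.pi, Real.sin θ ^ 3) = 1 / 5

/-- `L1_sphericalMean` holds: `(4/15)/(4/3) = 1/5`. [cite: Dodge2026, Lemma 1 p.4 l.9–10] -/
theorem l1_sphericalMean_holds : L1_sphericalMean := by
  unfold L1_sphericalMean
  rw [integral_sin_cube_mul_cos_sq, integral_sin_cube]; norm_num

/-- `L1_sphericalMean` — `_holds` alias of `l1_sphericalMean_holds` above under the fact's exact name (appended
2026-08-28, D-0026 bookkeeping: the proof term is the existing theorem of this file; no statement,
definition or attribute is edited; no new named fact; the ledger's debt table listed the fact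
unproved). [cite: Dodge2026, Lemma 1 p.4 l.9–10] -/
theorem _root_.Literature.Claims.NS.Dodge2026.L1_sphericalMean_holds : L1_sphericalMean :=
  _root_.Literature.Claims.NS.Dodge2026.l1_sphericalMean_holds

end Literature.Claims.NS.Dodge2026

end

-- WHAT THIS IS NOT: not a claim about NS regularity or blow-up; not a claim about any author beyond the
-- typed locator.
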